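import Mathlib
import Summits.Ventures.FusionMHD.Bench.SAlphaS2W405A15Panels
import Summits.Ventures.FusionMHD.Bench.SAlphaS2W405A417Panels
import Literature.MathematicalPhysics.MHD.BallooningSAlphaWitnessInterval
import HarnessLib

/-!
# F3 — THE UNSTABLE BAND OF THE `s–α` MODEL AT SHEAR `s = 2`, CERTIFIED UP TO THE SECOND-STABILITY EDGE: `U_2 ⊇ [3/2, 417/100]` — ONE
# finite-element trial function (window `[-6, 6]`, tuned at `α = 81/20`) is a witness at `α = 3/2` AND at `α = 417/100`, hence — the energy of a
# fixed trial function is a convex quadratic polynomial in `α` (`BallooningSAlphaWitnessInterval.unstableWitness_of_mem_Icc`) — at every `α` between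
(venture LADDER-GRIDFUSION, rung F3; cell `gridfusion`, typed by gridfusion-lit-3 (g14), 2026-08-28.  ONE composition file: 0 `def … : Prop` facts,
0 defs, 0 kit jobs, no `native_decide`, no floating point in any statement; 2 × 12 kernel panel enclosures in the panel files.)

## THREE COLUMNS
CERTIFIED (kernel): in the `s–α` ballooning MODEL (Freidberg (12.96)–(12.99), `Λ = sθ − α sin θ`, `θ₀ = 0`) at shear `s = 2`: for EVERY
`α ∈ [3/2, 417/100]` the explicit trial function `X = Spline.trialX (1/2) 1 SAlphaS2W405.pieces (-6)` (12 quintic pieces, `C²`, dofs in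
`2⁻²⁴ℤ`, `X(±6) = 0`) has NEGATIVE one-surface energy on `[-6, 6]` — `unstableWitness_15` (`W(3/2) ≈ −0.09074`), `unstableWitness_417`
(`W(417/100) ≈ −0.008841`; exact dyadic enclosures in `c15_seg_all` / `c417_seg_all`), then `unstableWitness_band` by convexity in `α`.  So
`U_2 ⊇ [3/2, 417/100]`: the band contains the top `lensHi (2) = 84/25` of model-7's two-turn lens (`Models/SAlphaTwoTurnLens`, `U_s ⊇ [lensLo s, lensHi s]`
for `1/2 ≤ s ≤ 3`), its lower end sits above the first-edge bracket of record `[1, 9/8]` / witness `(2, 5/4)` (★ #231), and its upper end lies `0.008` below the float second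
edge.  VALIDATED (not in the kernel): shooting edges `α₁(2) ≈ 1.175`, `α₂(2) ≈ 4.178`; the function's own float chord `(1.45, 4.174)`.  PAIRING (not
imported, not assumed): a certified STABLE point `(2, α⁺)` with `α⁺ > 417/100` would make `(417/100, α⁺)` a certified bracket of the SECOND edge at
`s = 2`; none is in the tree at the time of writing.  MODELLED: `s–α` model (large-aspect-ratio shifted circles, high-`n` ballooning ordering,
`θ₀ = 0`, ideal MHD); «unstable» = the model's one-surface functional (12.38)/(12.97) is negative on an explicit compactly supported differentiable
trial function vanishing at the ends of its window (lit-3's witness class, Newcomb sense); representation step (Connor–Hastie–Taylor 1979) quoted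
in `BallooningSAlpha.lean`, not typed; no device, no `β`-limit.  Citations: Freidberg 2014 §12.3 (12.38)–(12.40), §12.6.2 (12.97) [Freidberg2014];
Mahboubi–Melquiond–Sibut-Pinote 2016 §3.2–3.3 [MahboubiMelquiondSibutpinote2016].
-/

open Literature.Analysis.ValidatedNumerics Literature.Analysis.ValidatedNumerics.PolyMP
open Literature.Analysis.ValidatedNumerics.NumericsMP Literature.Analysis.ValidatedNumerics.ExpPoly
open Literature.MathematicalPhysics.MHD.Ballooning Literature.MathematicalPhysics.MHD.Ballooning.SAlpha
open Literature.MathematicalPhysics.MHD.Ballooning.SAlpha.Spline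
open Set

namespace Summit.Ventures.FusionMHD.Bench.SAlphaS2W405

/-- THE GLUED SEGMENT at `α = 3/2` in summed form. [cite: MahboubiMelquiondSibutpinote2016, Sect. 3.3] -/
theorem c15_seg_all :
    FSegOK (splineDensity 2 (3/2) (-6) (1/2) 1 pieces) [1] (2 ^ 60) (panelLeft (1/2) 0) (panelLeft (1/2) 12) (-104612221226582016) (-104612221213999104) := by
  have h := c15_seg
  norm_num at h
  exact h

/-- THE `[-6, 6]` TRIAL FUNCTION IS A WITNESS AT `(2, 3/2)`: `UnstableWitness 2 (3/2) (-6) 6 X X′`, `2⁶⁰·W ≤ -104612221213999104` (`W ≈ -0.0907`;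
enclosure `[-0.0907366, -0.0907366]`). [cite: Freidberg2014, §12.3 eqs. (12.38)–(12.40)] -/
theorem unstableWitness_15 :
    UnstableWitness 2 (3/2) (-6) 6 (trialX (1/2) 1 pieces (-6)) (trialX' (1/2) 1 pieces (-6)) := by
  have h := unstableWitness_of_spline (s := 2) (α := 3/2) (a := -6) (h := 1/2) (m := 1) (ps := pieces)
    (by norm_num : (0:ℚ) < 1/2) one_pos pieces_ne_nil pieces_match pieces_deriv_match head_zero last_zero c15_seg_all (by decide)
  rw [pieces_length] at h
  norm_num at h
  exact h

/-- THE GLUED SEGMENT at `α = 417/100` in summed form. [cite: MahboubiMelquiondSibutpinote2016, Sect. 3.3] -/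
theorem c417_seg_all :
    FSegOK (splineDensity 2 (417/100) (-6) (1/2) 1 pieces) [1] (2 ^ 60) (panelLeft (1/2) 0) (panelLeft (1/2) 12) (-10193335916429312) (-10193335903846400) := by
  have h := c417_seg
  norm_num at h
  exact h

/-- THE `[-6, 6]` TRIAL FUNCTION IS A WITNESS AT `(2, 417/100)`: `UnstableWitness 2 (417/100) (-6) 6 X X′`, `2⁶⁰·W ≤ -10193335903846400` (`W ≈ -0.0088`;
enclosure `[-0.0088413, -0.0088413]`). [cite: Freidberg2014, §12.3 eqs. (12.38)–(12.40)] -/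
theorem unstableWitness_417 :
    UnstableWitness 2 (417/100) (-6) 6 (trialX (1/2) 1 pieces (-6)) (trialX' (1/2) 1 pieces (-6)) := by
  have h := unstableWitness_of_spline (s := 2) (α := 417/100) (a := -6) (h := 1/2) (m := 1) (ps := pieces)
    (by norm_num : (0:ℚ) < 1/2) one_pos pieces_ne_nil pieces_match pieces_deriv_match head_zero last_zero c417_seg_all (by decide)
  rw [pieces_length] at h
  norm_num at h
  exact h

/-- ★★ THE BAND: the `[-6, 6]` trial function is a witness at EVERY `α ∈ [3/2, 417/100]` (the energy of a fixed trial function is a convex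
quadratic polynomial in `α`): `U_{2} ⊇ [3/2, 417/100]`. [cite: Freidberg2014, §12.3 eqs. (12.38)–(12.40)] («… The plasma is unstable», for the band of the MODEL) -/
theorem unstableWitness_band :
    ∀ α ∈ Icc (3/2 : ℝ) (417/100), UnstableWitness 2 α (-6) 6 (trialX (1/2) 1 pieces (-6)) (trialX' (1/2) 1 pieces (-6)) :=
  unstableWitness_of_mem_Icc unstableWitness_15 unstableWitness_417

/-- … hence every point of the band carries SOME witness, [cite: Freidberg2014, §12.3 eqs. (12.38)–(12.40)] -/
theorem exists_unstableWitness_of_mem_band {α : ℝ} (hα : α ∈ Icc (3/2 : ℝ) (417/100)) :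
    ∃ a b : ℝ, ∃ X X' : ℝ → ℝ, UnstableWitness 2 α a b X X' :=
  ⟨_, _, _, _, unstableWitness_band α hα⟩

/-- … and none is on the stable side. [cite: Freidberg2014, §12.3 eq. (12.40)] -/
theorem not_stableSide_of_mem_band {α : ℝ} (hα : α ∈ Icc (3/2 : ℝ) (417/100)) : ¬ StableSide 2 α := by
  obtain ⟨a, b, X, X', hw⟩ := exists_unstableWitness_of_mem_band hα
  exact fun hs => hs a b X X' hw

end Summit.Ventures.FusionMHD.Bench.SAlphaS2W405
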